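import Summits.QuantumFields.YangMills.Theorems.AlphaInputsT3ACv3AdaptedClass
import Summits.QuantumFields.YangMills.Theorems.BalabanUVNodesN21LocalAveragedRegularityLevels
import Summits.QuantumFields.YangMills.Theorems.UnitScaleTiltHistoryTailLocalProp1Regions
import Summits.QuantumFields.Balaban3D.Proofs.Run3Collar
import Literature.MathematicalPhysics.QuantumFieldTheory.Balaban1983to89.T3Thresholds
import HarnessLib

/-!
# `AlphaInputsT3ACv3Reg68LevelsOfFineRegular` — (68) AT EVERY LEVEL FROM REGIONAL FINE REGULARITY: `U ∈ AlphaInputsT3AC.reg68LevelsSet k h`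
# ([Balaban1985UV3] (68) p. 273, multi-level T³ form) from print's regional fine-plaquette bounds ([Balaban1985Variational] (2)∕(8) pp. 278–279,
# clause 1, region by region) by [Balaban1985Averaging] Prop. 2 (52)–(54) LOCAL and k-UNIFORM (the tree's `N21LocalAveragedRegularity`) and
# ONE collar inequality on the lane's regions ((39) p. 266), served by the record size `7L + 3 ≤ M₁`

Cell `ym3-torus` (HUMAN RULING D-0037, rung R3 — finite-torus SU(2) YM₃, NOT Clay), seat `ym-ust-19936-w4` (gen 4), WIDTH helper on stmt-QuantumFields-19936
`HistoryTailL`; plumbing row **r-68b** of the LEAD's B1 memo `B1-REGIONAL-THM1-LOCATE-w1-g3.md` §1 (LEAD B1 PLAN v1 (1); ★★OWNER ACK 22 (c) ∕ RULING g26-№8 (3):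
closure (a) «read the fine hypothesis one region down», collar binder `hM₁`).  `--supports stmt-QuantumFields-19936 --as helper`; def-free; count-neutral.

WHAT.  `reg68LevelsSet k h` (`AlphaInputsT3ACv3AdaptedClass` §2) asks, for `s ≤ i ≤ k` and every level-`s` plaquette `q` cornered in `Λ_i(h) = lam42 Ω(h) k i`,
`|Ū^s(∂q) − 1| ≤ C68·θBal(K−i)·L^{−2(i−s)}` for the `s`-fold `blockAvg ℰp`-average of the fine configuration `U`.  Print obtains it from the minimiser's fine
regularity (8) («`U_k ∈ 𝔘_k({Ω_j}, B₃ε₁)`» = (2) clause 1: `|∂U(p)| < const·L^{−2j}`, `p ⊂ Ω_j`) and [Balaban1985Averaging] Props. 1–2 (CMP 102 p. 267 l.1–3;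
p. 273 (68)→(69)).  Here, for ANY fine `U` that is `α_{i'}·L^{−2i'}`-small on the fine plaquettes cornered in EVERY region `Ω_{i'}(h)`, `i' ≤ k` (hypothesis
`hU`, the text of (2)∕(8) clause 1), the level-`s` averages under `Λ_i(h)` are `2L²·α_{i−1}·L^{−2(i−s)}`-small (`i ≥ 1`; `i = 0`: `Ω₀ = T_η`, the hypothesis),
hence `U ∈ reg68LevelsSet k h` under the displayed windows `2L²·α_{i−1} ≤ C68·θBal(K−i)`, `α₀ ≤ C68·θBal(K)`.

THE ONE GEOMETRIC SEAM (closure (a)).  The analytic step is the tree's LOCAL k-uniform Prop. 2 `N21LocalAveragedRegularity.plaqSmallOn_iter_blockAvg_eml_loc_level`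
(hypothesis on a FINE BOX below a chain of block centres, nested radii `L·r(j+1) + (d+4)L + 2 ≤ r(j)`); its hull around a level-`s` plaquette `q` is a fine
`ℓ^∞`-box of radius `r(0) = ((d+4)L+2)·Σ_{t<s} Lᵗ` around `toFine s q₋`, which may LEAVE `Ω_i(h)` (a union of big blocks with no inner margin around `Λ_i`).
It stays inside `Ω_{i−1}(h)`: a fine site outside `Ω_{i−1}(h)` is at scale-`(i−1)` distance `> Rcol(i−1)` from every point of `Ω_i(h)` (the collar (39) =
`Carriers.Regions.Omega`'s defining clause, `collar_of_mem_Omega`), while a hull corner is at fine `ℓ¹`-distance `≤ d·r(0) + 2` from `toFine s q₋ ∈ Ω_i(h)`,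
i.e. at scale-`(i−1)` distance `≤ (d·r(0) + 2)∕L^{i−1} + 2d < 32L + 19` (`pow_mul_sdist_le` iterating `Run3Collar.sdist_succ_le`; `2Σ_{t<i}Lᵗ ≤ 3L^{i−1}`,
`L ≥ 3`).  So the fine hypothesis is READ ONE REGION DOWN at the cost of one factor `L²` in the window (already carried by the record: `C68 ≥ 4B₃L²·B`,
`AlphaInputsT3ACMinimiserPinConsts.C68_dom_of_le`), under the collar row `32L + 18 ≤ Rcol(i−1)`, which the record size `7L + 3 ≤ M₁` serves:
`Rcol_j = ⌈R₁·r(g_j)⌉·M₁ ≥ 6M₁ ≥ 42L + 18` (`six_mul_M₁_le_rcolOf`, ★alpha-2's `collarE_T3_of_M₁_ge` computation).  WHY THE WINDOW IS DISPLAYED and not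
read off NODE O's `regClassC` (radius `½C68·θBal(K−j)`): one region down costs `2L²·θBal(K−i+1)∕θBal(K−i) ≥ 2L^{3∕2}` against a `C68`-to-`C68` window,
so the fine radius must be an INDEPENDENT letter (`B₃ε₁` in print's (8), `α` here) below `C68∕(2L²)` — exactly the record's `C68 ≥ 4B₃L²·B`.

CONTENTS.  §1 (generic `Params`): `radii_step`, `two_mul_sum_pow_le`, `sum_pow_le_sum_pow_of_le`, `toFine_chain`, `tdist_src_le_of_mem_boxRegion`,
`tdist_corner_le_of_mem_boxRegion`, `sdist_zero`, `pow_mul_sdist_le`, `collar_of_mem_Omega`, `mem_Omega_pred_of_tdist_le`, `lam42_subset_Omega`.  §2 (T³):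
`three_le_L`, `six_mul_M₁_le_rcolOf`, `mem_reg68LevelsSet_of_plaqSmallOn_Omega_of_collar` (collar displayed raw), ★ `mem_reg68LevelsSet_of_plaqSmallOn_Omega`
(collar binder = the record size `7L + 3 ≤ M₁`).  TRIVIAL-HISTORY twin: alpha-1's `MinimiserPinRows.row3_triv_of_levelBound` (global Prop. 2
`BlockAveragingEMLProp2.plaqSmall_iter_blockAvg_eml_level`).

HONEST FRAMING.  Kernel theorems about the tree's own objects; nothing of Bałaban's is asserted beyond the cited, already-proved Props. 1–2 for (0.4); the stub
`stub_laneRecordsV3Chi`, the crux `HistoryTailL`, NODE O d = 3 and B1 are NOT claimed; YM₃ on T³ = rung R3 — not d = 4, not infinite volume, no mass gap, not Clay.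

References: T. Bałaban, CMP 102 (1985) 255–275 [Balaban1985UV3] ((39) p.266, p.267 l.1–3, (68)–(69) p.273); CMP 102 (1985) 277–309 [Balaban1985Variational]
((2), (8) pp.278–279); CMP 98 (1985) 17–51 [Balaban1985Averaging] (Prop. 2 (52)–(54) p.26).
-/

set_option autoImplicit false

noncomputable section

open scoped BigOperators

namespace Summit.QuantumFields.YangMills.Theorems.Reg68LevelsOfFineRegular

open Literature.MathematicalPhysics.QuantumFieldTheory.Balaban1983to89
open Literature.MathematicalPhysics.QuantumFieldTheory.Balaban1983to89.ExpMeanLog (deltaSU expMeanLogSU)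
open Literature.MathematicalPhysics.QuantumFieldTheory.Balaban1983to89.B10 (rFun)
open Literature.MathematicalPhysics.QuantumFieldTheory.Balaban1983to89.B10LargeField (xlog one_le_xlog rFun_eq)
open Literature.MathematicalPhysics.QuantumFieldTheory.Balaban1983to89.T3Thresholds (θBal_le_of_le)
open Literature.MathematicalPhysics.QuantumFieldTheory.Balaban1983to89.BlockAveraging (blockAvg)
open Literature.MathematicalPhysics.QuantumFieldTheory.Balaban1983to89.T3ContinuumYM3Torus
open Literature.MathematicalPhysics.QuantumFieldTheory.Balaban1983to89.T3UnitLawDensityEML (ℰp)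
open Literature.MathematicalPhysics.QuantumFieldTheory.Balaban1983to89.T3UnitScaleTilt (θBal)
open Literature.MathematicalPhysics.QuantumFieldTheory.Balaban1983to89.B10Eq38TorusDomains (toFine toFine_zero toFine_succ cornerSet plaqsIn mem_plaqsIn_iff)
open Literature.MathematicalPhysics.QuantumFieldTheory.Balaban1983to89.B10Eq42TorusConstraint (lam42 lam42_of_lt lam42_self)
open Literature.MathematicalPhysics.QuantumFieldTheory.Balaban1983to89.B3Taylor310LocalRemainder (tdist_comm tdist_triangle)
open Literature.MathematicalPhysics.QuantumFieldTheory.Balaban1985CMP102.Setting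
open Summit.QuantumFields.Balaban3D.Carriers
open Summit.QuantumFields.Balaban3D.Proofs.Primitives (AlphaConsts)
open Summit.QuantumFields.Balaban3D.Proofs.ScalesArithmetic (gk_pos gk_le_one)
open Summit.QuantumFields.Balaban3D.Proofs.Run3Collar (sdist_succ_le tdist_shift_le)
open Summit.QuantumFields.YangMills.BalabanUVNodes.N20LCSAvgDominationRegion (boxRegion mem_boxRegion)
open Summit.QuantumFields.YangMills.Theorems.N21LocalAveragedRegularity (exists_embChain plaqSmallOn_iter_blockAvg_eml_loc_level)
open Summit.QuantumFields.YangMills.Theorems.HistoryTailLocalProp1 (tdist_le_of_sub_eq_intCast)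

/-! ## §1 Geometry of the hull of the local Prop. 2 below a plaquette, and the collar of the regions -/

section Geometry

variable {P : Params}

/-- **NESTED RADII, CLOSED FORM**: `r(j) = c·Σ_{t<s−j} Lᵗ` satisfies `L·r(j+1) + c = r(j)` for `j < s` (so `N21LocalAveragedRegularity`'s nesting
`L·r(j+1) + ((d+4)L+2) ≤ r(j)` holds with equality at `c = (d+4)L + 2`). [folklore] -/
theorem radii_step (c s : ℕ) {j : ℕ} (hj : j < s) :
    P.L * (c * ∑ t ∈ Finset.range (s - (j + 1)), P.L ^ t) + c = c * ∑ t ∈ Finset.range (s - j), P.L ^ t := by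
  have hs : s - j = (s - (j + 1)) + 1 := by omega
  rw [hs, Finset.sum_range_succ', pow_zero, mul_add, mul_one, Finset.mul_sum, Finset.mul_sum, Finset.mul_sum]
  exact congrArg₂ (· + ·) (Finset.sum_congr rfl fun t _ => by rw [pow_succ]; ring) rfl

/-- **THE GEOMETRIC-SUM LETTER**: `2·Σ_{t<i+1} Lᵗ ≤ 3·Lⁱ` for `L ≥ 3`. [folklore] -/
theorem two_mul_sum_pow_le {L : ℕ} (hL : 3 ≤ L) : ∀ i : ℕ, 2 * ∑ t ∈ Finset.range (i + 1), L ^ t ≤ 3 * L ^ i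
  | 0 => by simp
  | i + 1 => by
    rw [Finset.sum_range_succ, mul_add]
    have ih := two_mul_sum_pow_le hL i
    have h3 : 3 * L ^ i ≤ L * L ^ i := Nat.mul_le_mul_right _ hL
    calc 2 * ∑ t ∈ Finset.range (i + 1), L ^ t + 2 * L ^ (i + 1) ≤ 3 * L ^ i + 2 * L ^ (i + 1) := Nat.add_le_add_right ih _
      _ ≤ L * L ^ i + 2 * L ^ (i + 1) := Nat.add_le_add_right h3 _
      _ = 3 * L ^ (i + 1) := by rw [pow_succ]; ring

/-- The geometric sum is monotone in its length. [folklore] -/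
theorem sum_pow_le_sum_pow_of_le (L : ℕ) {s i : ℕ} (h : s ≤ i) : ∑ t ∈ Finset.range s, L ^ t ≤ ∑ t ∈ Finset.range i, L ^ t :=
  Finset.sum_le_sum_of_subset (Finset.range_mono h)

/-- **THE BOTTOM OF A CHAIN OF BLOCK CENTRES IS `toFine`**: if `xs j = emb (xs (j+1))` for `j < s`, then `toFine j (xs j) = xs 0` for `j ≤ s`.
[cite: Balaban1985UV3, (38) p.266] -/
theorem toFine_chain (xs : (i : ℕ) → Site P i) {s : ℕ} (hxs : ∀ i < s, xs i = emb (xs (i + 1))) :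
    ∀ j, j ≤ s → toFine j (xs j) = xs 0
  | 0, _ => rfl
  | j + 1, hj => by rw [toFine_succ, ← hxs j (by omega)]; exact toFine_chain xs hxs j (by omega)

/-- The base point of a plaquette of the box region of radius `ρ` around `x` is at `ℓ¹`-distance `≤ d·ρ` from `x`. [folklore] -/
theorem tdist_src_le_of_mem_boxRegion {j : ℕ} {x : Site P j} {ρ : ℕ} {p : Plaq P j} (hp : p ∈ boxRegion x ρ) :
    Site.tdist p.src x ≤ P.d * ρ := by
  classical
  choose e he using (mem_boxRegion.mp hp)
  refine tdist_le_of_sub_eq_intCast p.src x e ρ (fun κ => ?_) (fun κ => ?_)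
  · rw [(he κ).2]; abel
  · have h := (he κ).1; rw [← Int.natCast_natAbs] at h; exact_mod_cast h

/-- **THE HULL CORNERS ARE CLOSE**: every corner of a FINE plaquette of `boxRegion x ρ` is at `ℓ¹`-distance `≤ d·ρ + 2` from `x`. [folklore] -/
theorem tdist_corner_le_of_mem_boxRegion {x : Site P 0} {ρ : ℕ} {p : Plaq P 0} (hp : p ∈ boxRegion x ρ) {z : Site P 0}
    (hz : z ∈ cornerSet 0 p) : Site.tdist z x ≤ P.d * ρ + 2 := by
  have hsrc := tdist_src_le_of_mem_boxRegion hp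
  have h1 : ∀ (y : Site P 0) (μ : Fin P.d), Site.tdist (y.shift μ) x ≤ Site.tdist y x + 1 := fun y μ =>
    calc Site.tdist (y.shift μ) x ≤ Site.tdist (y.shift μ) y + Site.tdist y x := tdist_triangle _ _ _
      _ ≤ 1 + Site.tdist y x := Nat.add_le_add_right (by rw [tdist_comm]; exact tdist_shift_le y μ) _
      _ = Site.tdist y x + 1 := Nat.add_comm _ _
  simp only [cornerSet, toFine_zero, Set.mem_insert_iff, Set.mem_singleton_iff] at hz
  rcases hz with rfl | rfl | rfl | rfl
  · omega
  · have := h1 p.src p.μ; omega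
  · have := h1 p.src p.ν; omega
  · have := h1 (p.src.shift p.μ) p.ν; have := h1 p.src p.μ; omega

/-- `sdist 0` is the fine `ℓ¹` torus distance. [folklore] -/
theorem sdist_zero (x y : Site P 0) : sdist 0 x y = Site.tdist x y := rfl

/-- **SCALE CONTRACTION, ITERATED**: `Lʲ·sdist j x y ≤ sdist 0 x y + 2d·Lʲ` (`j` in the standing range; from `Run3Collar.sdist_succ_le`
`sdist (j+1) ≤ sdist j ∕ L + d` and `L ≥ 2`). [folklore] -/
theorem pow_mul_sdist_le (x y : Site P 0) : ∀ j : ℕ, j ≤ P.m + P.K → P.L ^ j * sdist j x y ≤ sdist 0 x y + 2 * P.d * P.L ^ j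
  | 0, _ => by simp
  | j + 1, hj => by
    have ih := pow_mul_sdist_le x y j (by omega)
    have hstep := sdist_succ_le (P := P) hj x y
    have hL : 2 ≤ P.L := by have := P.hL.2; omega
    have hdiv : P.L * (sdist j x y / P.L) ≤ sdist j x y := Nat.mul_div_le _ _
    have h1 : P.L * sdist (j + 1) x y ≤ sdist j x y + P.L * P.d := by
      calc P.L * sdist (j + 1) x y ≤ P.L * (sdist j x y / P.L + P.d) := Nat.mul_le_mul_left _ hstep
        _ = P.L * (sdist j x y / P.L) + P.L * P.d := Nat.mul_add _ _ _
        _ ≤ sdist j x y + P.L * P.d := Nat.add_le_add_right hdiv _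
    have h2 : P.L ^ (j + 1) * sdist (j + 1) x y ≤ P.L ^ j * sdist j x y + P.d * P.L ^ (j + 1) := by
      calc P.L ^ (j + 1) * sdist (j + 1) x y = P.L ^ j * (P.L * sdist (j + 1) x y) := by rw [pow_succ]; ring
        _ ≤ P.L ^ j * (sdist j x y + P.L * P.d) := Nat.mul_le_mul_left _ h1
        _ = P.L ^ j * sdist j x y + P.d * P.L ^ (j + 1) := by rw [pow_succ]; ring
    have h3 : 2 * P.L ^ j ≤ P.L ^ (j + 1) := by rw [pow_succ, mul_comm]; exact Nat.mul_le_mul_left _ hL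
    calc P.L ^ (j + 1) * sdist (j + 1) x y ≤ P.L ^ j * sdist j x y + P.d * P.L ^ (j + 1) := h2
      _ ≤ (sdist 0 x y + 2 * P.d * P.L ^ j) + P.d * P.L ^ (j + 1) := Nat.add_le_add_right ih _
      _ = sdist 0 x y + P.d * (2 * P.L ^ j) + P.d * P.L ^ (j + 1) := by ring
      _ ≤ sdist 0 x y + P.d * P.L ^ (j + 1) + P.d * P.L ^ (j + 1) :=
          Nat.add_le_add_right (Nat.add_le_add_left (Nat.mul_le_mul_left _ h3) _) _
      _ = sdist 0 x y + 2 * P.d * P.L ^ (j + 1) := by ring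

variable (M₁ : ℕ) (Rcol : ℕ → ℕ)

/-- **THE COLLAR (39) AT EVERY RECORDED INDEX**: for `1 ≤ j ≤ k`, a fine site outside `Ω_{j−1}(h)` is at scale-`(j−1)` distance `> Rcol (j−1)`
from every site of `Ω_j(h)` (the defining clause of `Carriers.Regions.Omega` at the passage `j−1 → j`, read at `y′ = y`, transported along the
history projections by `Omega_succ_of_le`). [cite: Balaban1985UV3, (39) p.266] -/
theorem collar_of_mem_Omega : ∀ (k : ℕ) (h : Hist P k) (j : ℕ), 1 ≤ j → j ≤ k →
    ∀ {y : Site P 0}, y ∈ Omega M₁ Rcol k h j → ∀ {x : Site P 0}, x ∉ Omega M₁ Rcol k h (j - 1) → Rcol (j - 1) < sdist (j - 1) x y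
  | 0, _, j, hj1, hjk, _, _, _, _ => by omega
  | k + 1, h, j, hj1, hjk, y, hy, x, hx => by
    by_cases hjk' : j ≤ k
    · rw [Omega_succ_of_le M₁ Rcol h hjk'] at hy
      rw [Omega_succ_of_le M₁ Rcol h (by omega : j - 1 ≤ k)] at hx
      exact collar_of_mem_Omega k h.proj j hj1 hjk' hy hx
    · obtain rfl : j = k + 1 := by omega
      rw [mem_Omega_succ_self] at hy
      exact hy y rfl x (Or.inr (by rwa [show k + 1 - 1 = k from rfl, Omega_succ_of_le M₁ Rcol h le_rfl] at hx))

/-- **THE HULL LEMMA**: for `1 ≤ i ≤ k`, a fine site `z` at `ℓ¹`-distance `≤ D` from a site `y ∈ Ω_i(h)` lies in `Ω_{i−1}(h)` as soon as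
`D + 2d·L^{i−1} < L^{i−1}·(Rcol(i−1) + 1)` (collar + scale contraction). [cite: Balaban1985UV3, (39) p.266] -/
theorem mem_Omega_pred_of_tdist_le {k : ℕ} (h : Hist P k) {i : ℕ} (hi1 : 1 ≤ i) (hik : i ≤ k) (him : i - 1 ≤ P.m + P.K)
    {y z : Site P 0} (hy : y ∈ Omega M₁ Rcol k h i) {D : ℕ} (hD : Site.tdist z y ≤ D)
    (hR : D + 2 * P.d * P.L ^ (i - 1) < P.L ^ (i - 1) * (Rcol (i - 1) + 1)) : z ∈ Omega M₁ Rcol k h (i - 1) := by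
  by_contra hz
  have hc := collar_of_mem_Omega M₁ Rcol k h i hi1 hik hy hz
  have hp := pow_mul_sdist_le z y (i - 1) him
  rw [sdist_zero] at hp
  have h1 : P.L ^ (i - 1) * (Rcol (i - 1) + 1) ≤ P.L ^ (i - 1) * sdist (i - 1) z y := Nat.mul_le_mul_left _ hc
  omega

/-- `Λ_i(h) ⊆ Ω_i(h)`: the read region `lam42 Ω k i` is contained in `Ω i` (both for `i < k` and `i = k`). [cite: Balaban1985UV3, (40)–(42) p.266] -/
theorem lam42_subset_Omega (Ω : ℕ → Set (Site P 0)) (k i : ℕ) (hik : i ≤ k) : lam42 Ω k i ⊆ Ω i := by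
  rcases Nat.lt_or_ge i k with hlt | hge
  · rw [lam42_of_lt hlt]; exact fun x hx => hx.1
  · obtain rfl : i = k := le_antisymm hik hge; rw [lam42_self]

end Geometry

/-! ## §2 (68) at every level from regional fine regularity, at the T³ objects -/

section T3

variable (F : T3Family) (𝔠 : AlphaConsts F.L (suGroupModel 2).N) (γ : ℝ) (hγ : 0 < γ) (hγ1 : γ ≤ (min 𝔠.gamma0 1) ^ 2) (K : ℕ)

/-- `3 ≤ L` for the family's block size (`L` odd, `> 1`). [folklore] -/
theorem three_le_L : 3 ≤ F.L := by
  obtain ⟨hodd, h1⟩ := F.hL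
  rcases hodd with ⟨t, ht⟩
  omega

/-- **THE COLLAR ROW FROM THE RECORD'S BIG-BLOCK SIZE**: `6·M₁ ≤ Rcol_j = ⌈R₁·r(g_j)⌉·M₁` for every `j ≤ K` (`R₁ ≥ 6 + 2κ₀ ≥ 6`,
`r(g_j) = (1 + log g_j⁻¹)^{r₀} ≥ 1` as `g_j ≤ 1`; ★alpha-2's `collarE_T3_of_M₁_ge` computation); with the record size `7L + 3 ≤ M₁` this is `≥ 42L + 18`.
[cite: Balaban1985UV3, (7) p.257 and (39) p.266] -/
theorem six_mul_M₁_le_rcolOf (j : ℕ) (hj : j ≤ K) :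
    6 * 𝔠.M₁ ≤ rcolOf (T3Scales F γ hγ (hγ1.trans (sq_min_one_le _ 𝔠.gamma0_pos)) K) 𝔠.lane.carrier j := by
  set S : Scales F.L := T3Scales F γ hγ (hγ1.trans (sq_min_one_le _ 𝔠.gamma0_pos)) K with hS
  have hg := gk_pos S j
  have hg1 : S.gk j ≤ 1 := gk_le_one S S.gK_le_one j (show j ≤ K from hj)
  have hx : 1 ≤ xlog (S.gk j) := one_le_xlog hg hg1
  have hr : 1 ≤ rFun 𝔠.r₀ (S.gk j) := by
    rw [rFun_eq]
    exact Real.one_le_rpow hx (by linarith [𝔠.one_le_r₀])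
  have hR₁ : (6 : ℝ) ≤ 𝔠.R₁ := by have := 𝔠.R₁_ge; have := 𝔠.κ₀_pos; linarith
  have h6 : (6 : ℝ) ≤ 𝔠.R₁ * rFun 𝔠.r₀ (S.gk j) := by nlinarith
  have hceil : 6 ≤ ⌈𝔠.R₁ * rFun 𝔠.r₀ (S.gk j)⌉₊ := by
    have := h6.trans (Nat.le_ceil (𝔠.R₁ * rFun 𝔠.r₀ (S.gk j)))
    exact_mod_cast this
  show 6 * 𝔠.M₁ ≤ ⌈𝔠.R₁ * rFun 𝔠.r₀ (S.gk j)⌉₊ * 𝔠.M₁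
  exact Nat.mul_le_mul_right _ hceil

/-- **(68) AT EVERY LEVEL FROM REGIONAL FINE REGULARITY — ABSTRACT COLLAR FORM** (r-68b with the collar displayed raw, `32L + 18 ≤ Rcol(i−1)`; hypotheses
and proof as in ★ `mem_reg68LevelsSet_of_plaqSmallOn_Omega` below). [cite: Balaban1985UV3, (68) p.273; Balaban1985Averaging, Prop. 2 (52)–(54) p.26] -/
theorem mem_reg68LevelsSet_of_plaqSmallOn_Omega_of_collar {k : ℕ} (hk : k ≤ K) (h : Hist (F.P K) k)
    {U : GaugeField (F.P K) 0 (Matrix.specialUnitaryGroup (Fin 2) ℂ)} {α : ℕ → ℝ} (hα : ∀ i, i ≤ k → 0 < α i)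
    (hU : ∀ i, i ≤ k → PlaqSmallOn (↑(plaqsIn 0 (Omega 𝔠.lane.carrier.M₁
        (rcolOf (T3Scales F γ hγ (hγ1.trans (sq_min_one_le _ 𝔠.gamma0_pos)) K) 𝔠.lane.carrier) k h i)) : Set (Plaq (F.P K) 0))
        (α i * (((F.L : ℝ) ^ i)⁻¹) ^ 2) U)
    (hsmall : ∀ i, i ≤ k → (143 * ((7 : ℝ) ^ 2 / 4) ^ 2) * ((F.L : ℝ) ^ 2 * α i) ≤ 1 / 3 ∧
        2 * ((F.L : ℝ) ^ 2 * α i) ≤ 2 * deltaSU (Fin 2) / ((7 * F.L : ℕ) : ℝ) ^ 2)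
    (hcol : ∀ i, 1 ≤ i → i ≤ k → 32 * F.L + 18 ≤ rcolOf (T3Scales F γ hγ (hγ1.trans (sq_min_one_le _ 𝔠.gamma0_pos)) K) 𝔠.lane.carrier (i - 1))
    (hwin0 : α 0 ≤ 𝔠.C68 * θBal F.L γ 𝔠.b₀ 𝔠.p₀ K)
    (hwin : ∀ i, 1 ≤ i → i ≤ k → 2 * ((F.L : ℝ) ^ 2 * α (i - 1)) ≤ 𝔠.C68 * θBal F.L γ 𝔠.b₀ 𝔠.p₀ (K - i)) :
    U ∈ AlphaInputsT3AC.reg68LevelsSet F 𝔠 γ hγ hγ1 K k h := by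
  set S := T3Scales F γ hγ (hγ1.trans (sq_min_one_le _ 𝔠.gamma0_pos)) K with hS
  set Ω : ℕ → Set (Site (F.P K) 0) := Omega 𝔠.lane.carrier.M₁ (rcolOf S 𝔠.lane.carrier) k h with hΩ
  show ∀ i, i ≤ k → ∀ s, s ≤ i → ∀ q : Plaq (F.P K) s, q ∈ plaqsIn s (lam42 Ω k i) →
    GaugeGroup.dist1 (GaugeField.plaqHol (Averaging.iter (fun l => BlockAveraging.blockAvg (P := F.P K) (j := l) ℰp) s U) q) ≤
      𝔠.C68 * θBal F.L γ 𝔠.b₀ 𝔠.p₀ (K - i) * ((((F.L : ℝ) ^ (i - s))⁻¹) ^ 2)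
  intro i hik s hsi q hq
  have hL3 : 3 ≤ F.L := three_le_L F
  have hLpos : (0 : ℝ) < (F.L : ℝ) := by exact_mod_cast (show 0 < F.L by omega)
  have hqΩ : cornerSet s q ⊆ Ω i := (mem_plaqsIn_iff.mp hq).trans (lam42_subset_Omega Ω k i hik)
  rcases Nat.eq_zero_or_pos i with rfl | hipos
  · -- `i = 0`: `s = 0`, `Ω₀ = T_η`, the hypothesis itself
    obtain rfl : s = 0 := Nat.le_zero.mp hsi
    have hq0 : q ∈ plaqsIn 0 (Ω 0) := mem_plaqsIn_iff.mpr hqΩ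
    have hlt := hU 0 hik q (Finset.mem_coe.mpr hq0)
    rw [show (((F.L : ℝ) ^ (0 - 0))⁻¹) ^ 2 = 1 by simp, mul_one, Nat.sub_zero]
    rw [show α 0 * (((F.L : ℝ) ^ 0)⁻¹) ^ 2 = α 0 by simp] at hlt
    exact (le_of_lt hlt).trans hwin0
  · -- `i ≥ 1`: local Prop. 2 on the hull, read in `Ω_{i−1}(h)`
    have hi1 : 1 ≤ i := hipos
    obtain ⟨xs, hxs_top, hxs⟩ := exists_embChain (P := F.P K) s q.src
    have hy0 : toFine s q.src = xs 0 := by rw [← hxs_top]; exact toFine_chain xs hxs s le_rfl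
    have hyΩ : xs 0 ∈ Ω i := by rw [← hy0]; exact hqΩ (Set.mem_insert _ _)
    -- the radii of the hull
    set c : ℕ := ((F.P K).d + 4) * (F.P K).L + 2 with hc
    set r : ℕ → ℕ := fun j => c * ∑ t ∈ Finset.range (s - j), (F.P K).L ^ t with hr
    have hrstep : ∀ j < s, (F.P K).L * r (j + 1) + (((F.P K).d + 4) * (F.P K).L + 2) ≤ r j := fun j hj => by
      rw [hr]; exact (radii_step c s hj).le
    -- the hull lies in `Ω_{i−1}(h)`
    have hPL : (F.P K).L = F.L := rfl
    have hPd : (F.P K).d = 3 := rfl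
    have hr0 : r 0 = c * ∑ t ∈ Finset.range s, F.L ^ t := by rw [hr]; simp
    have hsum : 2 * ∑ t ∈ Finset.range s, F.L ^ t ≤ 3 * F.L ^ (i - 1) := by
      have h1 : ∑ t ∈ Finset.range s, F.L ^ t ≤ ∑ t ∈ Finset.range (i - 1 + 1), F.L ^ t :=
        sum_pow_le_sum_pow_of_le F.L (by omega)
      exact (Nat.mul_le_mul_left 2 h1).trans (two_mul_sum_pow_le hL3 (i - 1))
    have him : i - 1 ≤ (F.P K).m + (F.P K).K := by
      show i - 1 ≤ F.m + K; omega
    have hhull : ∀ p ∈ boxRegion (xs 0) (r 0), p ∈ plaqsIn 0 (Ω (i - 1)) := by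
      intro p hp
      refine mem_plaqsIn_iff.mpr fun z hz => ?_
      refine mem_Omega_pred_of_tdist_le 𝔠.lane.carrier.M₁ (rcolOf S 𝔠.lane.carrier) h hi1 hik him hyΩ
        (tdist_corner_le_of_mem_boxRegion hp hz) ?_
      -- `d·r(0) + 2 + 2d·L^{i−1} < L^{i−1}·(Rcol(i−1) + 1)` from the collar row
      have hR := hcol i hi1 hik
      rw [hPd, hPL, hr0]
      have hc' : c = 7 * F.L + 2 := by rw [hc, hPd, hPL]
      rw [hc']
      have hLi : 1 ≤ F.L ^ (i - 1) := Nat.one_le_pow _ _ (by omega)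
      -- `2·(3·(7L+2)·Σ + 2 + 6·L^{i−1}) ≤ (63L + 34)·L^{i−1} < 2·L^{i−1}·(32L + 19) ≤ 2·L^{i−1}·(Rcol(i−1) + 1)` by `2Σ ≤ 3L^{i−1}`
      set Pw : ℕ := F.L ^ (i - 1) with hPw
      set Sg : ℕ := ∑ t ∈ Finset.range s, F.L ^ t with hSg
      have key : 2 * (3 * ((7 * F.L + 2) * Sg) + 2 + 2 * 3 * Pw) ≤ (63 * F.L + 34) * Pw :=
        calc 2 * (3 * ((7 * F.L + 2) * Sg) + 2 + 2 * 3 * Pw) = 3 * (7 * F.L + 2) * (2 * Sg) + 4 + 12 * Pw := by ring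
          _ ≤ 3 * (7 * F.L + 2) * (3 * Pw) + 4 * Pw + 12 * Pw :=
              Nat.add_le_add_right (Nat.add_le_add (Nat.mul_le_mul_left _ hsum) (by omega)) _
          _ = (63 * F.L + 34) * Pw := by ring
      have key2 : (63 * F.L + 34) * Pw < 2 * (Pw * (rcolOf S 𝔠.lane.carrier (i - 1) + 1)) :=
        calc (63 * F.L + 34) * Pw < (64 * F.L + 38) * Pw := Nat.mul_lt_mul_of_pos_right (by omega) (by omega)
          _ = 2 * (Pw * ((32 * F.L + 18) + 1)) := by ring
          _ ≤ 2 * (Pw * (rcolOf S 𝔠.lane.carrier (i - 1) + 1)) :=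
              Nat.mul_le_mul_left _ (Nat.mul_le_mul_left _ (Nat.add_le_add_right hR _))
      exact Nat.lt_of_mul_lt_mul_left (lt_of_le_of_lt key key2)
    -- the fine hypothesis on the hull, in Prop. 2's currency `α₀·(Lˢ)⁻²`
    set a : ℝ := α (i - 1) with ha
    have hapos : 0 < a := hα (i - 1) (by omega)
    set α₀ : ℝ := a * ((F.L : ℝ) ^ s * ((F.L : ℝ) ^ (i - 1))⁻¹) ^ 2 with hα₀
    have hLs : (0 : ℝ) < (F.L : ℝ) ^ s := by positivity
    have hLi1 : (0 : ℝ) < (F.L : ℝ) ^ (i - 1) := by positivity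
    have hα₀pos : 0 < α₀ := by positivity
    have hα₀_eq : α₀ * (((F.L : ℝ) ^ s)⁻¹) ^ 2 = a * (((F.L : ℝ) ^ (i - 1))⁻¹) ^ 2 := by
      rw [hα₀]; field_simp
    -- `α₀ ≤ L²·a` since `s ≤ i`
    have hratio : (F.L : ℝ) ^ s * ((F.L : ℝ) ^ (i - 1))⁻¹ ≤ (F.L : ℝ) := by
      rw [mul_inv_le_iff₀ hLi1, ← pow_succ']
      exact pow_le_pow_right₀ (by exact_mod_cast (show 1 ≤ F.L by omega)) (by omega)
    have hratio0 : 0 ≤ (F.L : ℝ) ^ s * ((F.L : ℝ) ^ (i - 1))⁻¹ := by positivity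
    have hα₀le : α₀ ≤ (F.L : ℝ) ^ 2 * a := by
      rw [hα₀]
      have : ((F.L : ℝ) ^ s * ((F.L : ℝ) ^ (i - 1))⁻¹) ^ 2 ≤ (F.L : ℝ) ^ 2 := by
        rw [sq, sq]; exact mul_le_mul hratio hratio hratio0 hLpos.le
      calc a * ((F.L : ℝ) ^ s * ((F.L : ℝ) ^ (i - 1))⁻¹) ^ 2 ≤ a * (F.L : ℝ) ^ 2 := mul_le_mul_of_nonneg_left this hapos.le
        _ = (F.L : ℝ) ^ 2 * a := mul_comm _ _
    obtain ⟨hs3, hs2⟩ := hsmall (i - 1) (by omega)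
    have hα3 : (143 * (((((F.P K).d + 4 : ℕ) : ℝ)) ^ 2 / 4) ^ 2) * α₀ ≤ 1 / 3 := by
      have e : ((((F.P K).d + 4 : ℕ) : ℝ)) = 7 := by rw [hPd]; norm_num
      rw [e]
      have h0 : 0 ≤ 143 * ((7 : ℝ) ^ 2 / 4) ^ 2 := by positivity
      exact (mul_le_mul_of_nonneg_left hα₀le h0).trans hs3
    have hα2 : 2 * α₀ ≤ 2 * deltaSU (Fin 2) / ((((F.P K).d + 4) * (F.P K).L : ℕ) : ℝ) ^ 2 := by
      have e : ((((F.P K).d + 4) * (F.P K).L : ℕ) : ℝ) = ((7 * F.L : ℕ) : ℝ) := by rw [hPd, hPL]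
      rw [e]
      exact le_trans (by linarith [hα₀le]) hs2
    have h52 : PlaqSmallOn (↑(boxRegion (xs 0) (r 0)) : Set (Plaq (F.P K) 0)) (α₀ * ((((F.P K).L : ℝ) ^ s)⁻¹) ^ 2) U := by
      intro p hp
      have hp' : p ∈ plaqsIn 0 (Ω (i - 1)) := hhull p (Finset.mem_coe.mp hp)
      have hlt := hU (i - 1) (by omega) p (Finset.mem_coe.mpr hp')
      rw [hPL, hα₀_eq]
      exact hlt
    -- the local Prop. 2 at the top of the chain
    have hN := plaqSmallOn_iter_blockAvg_eml_loc_level (n := Fin 2) (P := F.P K) s hα₀pos hα3 hα2 xs hxs r hrstep h52 (j := s) le_rfl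
    have hqbox : q ∈ boxRegion (xs s) (r s) := by
      rw [hxs_top, mem_boxRegion]
      intro ν
      exact ⟨0, by rw [hr]; simp, by simp⟩
    have hlt := hN q (Finset.mem_coe.mpr hqbox)
    -- arithmetic: `2α₀·(Lˢ·(Lˢ)⁻¹)² = (2L²a)·L^{−2(i−s)} ≤ C68·θBal(K−i)·L^{−2(i−s)}`
    have hone : ((F.P K).L : ℝ) ^ s * (((F.P K).L : ℝ) ^ s)⁻¹ = 1 := by
      rw [hPL]; exact mul_inv_cancel₀ hLs.ne'
    rw [hone, one_pow, mul_one] at hlt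
    refine hlt.le.trans ?_
    have hw := hwin i hi1 hik
    have hx0 : (0 : ℝ) ≤ (((F.L : ℝ) ^ (i - s))⁻¹) ^ 2 := by positivity
    have hfac : ((F.L : ℝ) ^ s * ((F.L : ℝ) ^ (i - 1))⁻¹) ^ 2 = (F.L : ℝ) ^ 2 * (((F.L : ℝ) ^ (i - s))⁻¹) ^ 2 := by
      have hLis : (0 : ℝ) < (F.L : ℝ) ^ (i - s) := by positivity
      have hbase : (F.L : ℝ) ^ s * ((F.L : ℝ) ^ (i - 1))⁻¹ = (F.L : ℝ) * ((F.L : ℝ) ^ (i - s))⁻¹ := by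
        rw [← div_eq_mul_inv, ← div_eq_mul_inv, div_eq_div_iff hLi1.ne' hLis.ne', ← pow_add, ← pow_succ']; congr 1; omega
      rw [hbase, mul_pow]
    calc 2 * α₀ = 2 * ((F.L : ℝ) ^ 2 * a) * (((F.L : ℝ) ^ (i - s))⁻¹) ^ 2 := by rw [hα₀, hfac]; ring
      _ ≤ 𝔠.C68 * θBal F.L γ 𝔠.b₀ 𝔠.p₀ (K - i) * (((F.L : ℝ) ^ (i - s))⁻¹) ^ 2 := mul_le_mul_of_nonneg_right hw hx0

/-- ★ **(68) AT EVERY LEVEL FROM REGIONAL FINE REGULARITY** (plumbing row r-68b; the regional twin of alpha-1's `MinimiserPin.row3_triv_of_levelBound`).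
For a fine configuration `U` of run `K`, `k ≤ K`, a level-`k` history `h` and `α : ℕ → ℝ₊`: if (hU) for every `i ≤ k` every FINE plaquette cornered in `Ω_i(h)` has
`|U(∂p) − 1| < α_i·L^{−2i}` (print's (2)∕(8) clause 1, region by region — the only analytic input), (hsmall) `C₀(3)·L²α_i ≤ ⅓`, `2L²α_i ≤ 2δ₂∕(7L)²`
(Prop. 2's smallness one factor `L²` up), (hM₁) the record size `7L + 3 ≤ M₁` (serves the collar `32L + 18 ≤ 6M₁ ≤ Rcol(i−1)`), and the windows (hwin0)
`α₀ ≤ C68·θBal(K)`, (hwin) `2L²·α_{i−1} ≤ C68·θBal(K−i)` (`1 ≤ i ≤ k`), then `U ∈ reg68LevelsSet k h`.  Proof: `i = 0` — `Ω₀ = T_η`, the hypothesis; `i ≥ 1` —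
`N21LocalAveragedRegularity.plaqSmallOn_iter_blockAvg_eml_loc_level` along the chain of block centres below `q₋` (radii `((d+4)L+2)·Σ_{t<s−j}Lᵗ`), fed on its
hull — inside `Ω_{i−1}(h)` by `mem_Omega_pred_of_tdist_le` — by (hU) at region `i−1`; output `2α_{i−1}·L^{2s−2(i−1)} = (2L²α_{i−1})·L^{−2(i−s)}`.
[cite: Balaban1985UV3, (68) p.273; Balaban1985Averaging, Prop. 2 (52)–(54) p.26] -/
theorem mem_reg68LevelsSet_of_plaqSmallOn_Omega {k : ℕ} (hk : k ≤ K) (h : Hist (F.P K) k)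
    {U : GaugeField (F.P K) 0 (Matrix.specialUnitaryGroup (Fin 2) ℂ)} {α : ℕ → ℝ} (hα : ∀ i, i ≤ k → 0 < α i)
    (hU : ∀ i, i ≤ k → PlaqSmallOn (↑(plaqsIn 0 (Omega 𝔠.lane.carrier.M₁
        (rcolOf (T3Scales F γ hγ (hγ1.trans (sq_min_one_le _ 𝔠.gamma0_pos)) K) 𝔠.lane.carrier) k h i)) : Set (Plaq (F.P K) 0))
        (α i * (((F.L : ℝ) ^ i)⁻¹) ^ 2) U)
    (hsmall : ∀ i, i ≤ k → (143 * ((7 : ℝ) ^ 2 / 4) ^ 2) * ((F.L : ℝ) ^ 2 * α i) ≤ 1 / 3 ∧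
        2 * ((F.L : ℝ) ^ 2 * α i) ≤ 2 * deltaSU (Fin 2) / ((7 * F.L : ℕ) : ℝ) ^ 2)
    (hM₁ : 7 * F.L + 3 ≤ 𝔠.M₁)
    (hwin0 : α 0 ≤ 𝔠.C68 * θBal F.L γ 𝔠.b₀ 𝔠.p₀ K)
    (hwin : ∀ i, 1 ≤ i → i ≤ k → 2 * ((F.L : ℝ) ^ 2 * α (i - 1)) ≤ 𝔠.C68 * θBal F.L γ 𝔠.b₀ 𝔠.p₀ (K - i)) :
    U ∈ AlphaInputsT3AC.reg68LevelsSet F 𝔠 γ hγ hγ1 K k h :=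
  mem_reg68LevelsSet_of_plaqSmallOn_Omega_of_collar F 𝔠 γ hγ hγ1 K hk h hα hU hsmall
    (fun i hi1 hik =>
      calc 32 * F.L + 18 ≤ 6 * (7 * F.L + 3) := by omega
        _ ≤ 6 * 𝔠.M₁ := Nat.mul_le_mul_left _ hM₁
        _ ≤ _ := six_mul_M₁_le_rcolOf F 𝔠 γ hγ hγ1 K (i - 1) (by omega))
    hwin0 hwin

end T3

end Summit.QuantumFields.YangMills.Theorems.Reg68LevelsOfFineRegular

end
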